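import Summits.AtomisticToContinuum.Crystallization.Theorems.PalmUnimodularRigidityShellsToBarlowChartTransportOpsDefs
import Summits.AtomisticToContinuum.Crystallization.Theorems.PalmUnimodularRigidityShellsToBarlowChartCharts
import Summits.AtomisticToContinuum.Crystallization.Theorems.PalmUnimodularRigidityShellsToBarlowChartTransportPatterns1
import Summits.AtomisticToContinuum.Crystallization.Theorems.PalmUnimodularRigidityShellsToBarlowChartTransportPatterns2
import Summits.AtomisticToContinuum.Crystallization.Theorems.PalmUnimodularRigidityShellsToBarlowChartTransportPatterns3
import Summits.AtomisticToContinuum.Crystallization.Theorems.PalmUnimodularRigidityShellsToBarlowChartTransportPatterns4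
import Summits.AtomisticToContinuum.Crystallization.Theorems.PalmUnimodularRigidityShellsToBarlowChartTransportPatterns5
import Summits.AtomisticToContinuum.Crystallization.Theorems.PalmUnimodularRigidityShellsToBarlowChartTransportPatterns6
import Summits.AtomisticToContinuum.Crystallization.Theorems.PalmUnimodularRigidityShellsToBarlowChartTransportPatterns7
import Summits.AtomisticToContinuum.Crystallization.Theorems.PalmUnimodularRigidityShellsToBarlowChartTransportPatterns8
import Summits.AtomisticToContinuum.Crystallization.Theorems.PalmUnimodularRigidityShellsToBarlowChartTransportPatterns9
import Summits.AtomisticToContinuum.Crystallization.Theorems.PalmUnimodularRigidityShellsToBarlowChartTransportPatterns10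
import Summits.AtomisticToContinuum.Crystallization.Theorems.PalmUnimodularRigidityShellsToBarlowChartTransportPatterns11
import Summits.AtomisticToContinuum.Crystallization.Theorems.PalmUnimodularRigidityShellsToBarlowChartTransportPatterns12
import Summits.AtomisticToContinuum.Crystallization.Theorems.PalmUnimodularRigidityShellsToBarlowChartTransportPatterns13
import Summits.AtomisticToContinuum.Crystallization.Theorems.PalmUnimodularRigidityShellsToBarlowChartTransportPatterns14

/-!
# Line `develop-the-model-growth-descent` (crux `ShellsToBarlowChart`, stmt-AtomisticToContinuum-9227): the four in-layer transports `I, J, I⁻¹, J⁻¹` and the vertical transport `V` of frames read in integer charts (specifications, inverse identities, apexes) (part 1/7)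

Helper lemmas for `stub_transportSystem` (the geometric half of the line): frames `⟨x, t₁, t₂, U⟩`
read in the integer charts `IsZChart` of a good-shell configuration, their transports and the
coherence of the resulting development `frameAt`.  The only metric inputs are the chart transfer
lemma and `bond_nb_iff`; everything else is label combinatorics in `ℤ³` (pattern facts
`TransportPatterns*`).  All `[folklore]` (HalesDSP2012 §1.3 for the two kissing patterns).
-/

noncomputable section

namespace Summit.AtomisticToContinuum.Crystallization.Theorems.PalmUnimodularRigidityShellsToBarlowChart

open Literature.Geometry.DiscreteGeometry Literature.MathematicalPhysics.StatisticalMechanics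
open Summit.AtomisticToContinuum.Crystallization.Theorems.ShellsToBarlowChartNegative

variable {S : Set (EuclideanSpace ℝ (Fin 3))} {ac : (EuclideanSpace ℝ (Fin 3)) → ℝ} {Pc : (EuclideanSpace ℝ (Fin 3)) → Finset (Fin 3 → ℤ)}
  {Ac : (EuclideanSpace ℝ (Fin 3)) → ((EuclideanSpace ℝ (Fin 3)) →ₗᵢ[ℝ] (EuclideanSpace ℝ (Fin 3)))} {nb : (EuclideanSpace ℝ (Fin 3)) → (Fin 3 → ℤ) → (EuclideanSpace ℝ (Fin 3))}

/-- The bond relation (distance in `(0, 28/25]`) is symmetric. [folklore] -/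
theorem bond_symm {x y : (EuclideanSpace ℝ (Fin 3))} (h : 0 < dist x y ∧ dist x y ≤ 28 / 25) : 0 < dist y x ∧ dist y x ≤ 28 / 25 := by rw [dist_comm]; exact h

/-- A labelled neighbour is a site of `S` bonded to the centre. [folklore] -/
theorem nb_mem (hch : ∀ z ∈ S, IsZChart S z (ac z) (Pc z) (Ac z) (nb z)) {x : (EuclideanSpace ℝ (Fin 3))} (hx : x ∈ S)
    {t : Fin 3 → ℤ} (ht : t ∈ Pc x) : nb x t ∈ S ∧ (0 < dist x (nb x t) ∧ dist x (nb x t) ≤ 28 / 25) :=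
  (hch x hx).2.2.2.1.mapsTo ht

/-- The inverse labelling of a bonded neighbour is a label and labels it. [folklore] -/
theorem zlab_spec (hch : ∀ z ∈ S, IsZChart S z (ac z) (Pc z) (Ac z) (nb z)) {y z : (EuclideanSpace ℝ (Fin 3))} (hy : y ∈ S)
    (hz : z ∈ S) (hb : 0 < dist y z ∧ dist y z ≤ 28 / 25) :
    zlab Pc nb y z ∈ Pc y ∧ nb y (zlab Pc nb y z) = z := by
  have hbij := (hch y hy).2.2.2.1
  have hmem : z ∈ {w | w ∈ S ∧ (0 < dist y w ∧ dist y w ≤ 28 / 25)} := ⟨hz, hb⟩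
  obtain ⟨t, ht, htz⟩ := hbij.surjOn hmem
  have hex : ∃ t ∈ (↑(Pc y) : Set (Fin 3 → ℤ)), nb y t = z := ⟨t, ht, htz⟩
  exact ⟨Function.invFunOn_mem hex, Function.invFunOn_eq hex⟩

/-- The inverse labelling inverts the labelling on labels. [folklore] -/
theorem zlab_nb (hch : ∀ z ∈ S, IsZChart S z (ac z) (Pc z) (Ac z) (nb z)) {y : (EuclideanSpace ℝ (Fin 3))} (hy : y ∈ S)
    {t : Fin 3 → ℤ} (ht : t ∈ Pc y) : zlab Pc nb y (nb y t) = t :=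
  (hch y hy).2.2.2.1.invOn_invFunOn.1 ht

/-- Bonds among labelled neighbours are the label pairs at squared distance `18`. [folklore] -/
theorem bond_nb_iff (hch : ∀ z ∈ S, IsZChart S z (ac z) (Pc z) (Ac z) (nb z)) {x : (EuclideanSpace ℝ (Fin 3))} (hx : x ∈ S)
    {t t' : Fin 3 → ℤ} (ht : t ∈ Pc x) (ht' : t' ∈ Pc x) :
    (0 < dist (nb x t) (nb x t') ∧ dist (nb x t) (nb x t') ≤ 28 / 25) ↔ sqNormInt (t - t') = 18 :=
  (hch x hx).2.2.2.2.2 t ht t' ht'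

/-- The pattern of a chart is FCC or HCP. [folklore] -/
theorem pattern_cases (hch : ∀ z ∈ S, IsZChart S z (ac z) (Pc z) (Ac z) (nb z)) {x : (EuclideanSpace ℝ (Fin 3))} (hx : x ∈ S) :
    Pc x = fcc3Int ∨ Pc x = hcpInt := (hch x hx).1

/-- **Transfer for two labelled neighbours of `x`** that are also bonded neighbours of the bonded
site `y`: their squared label distance at `y` is the one at `x`. [folklore] -/
theorem transfer_nb_nb (hch : ∀ z ∈ S, IsZChart S z (ac z) (Pc z) (Ac z) (nb z)) {x y : (EuclideanSpace ℝ (Fin 3))}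
    (hx : x ∈ S) (hy : y ∈ S) (hxy : 0 < dist x y ∧ dist x y ≤ 28 / 25)
    {t t' : Fin 3 → ℤ} (ht : t ∈ Pc x) (ht' : t' ∈ Pc x)
    (hzt : 0 < dist y (nb x t) ∧ dist y (nb x t) ≤ 28 / 25)
    (hzt' : 0 < dist y (nb x t') ∧ dist y (nb x t') ≤ 28 / 25) :
    sqNormInt (zlab Pc nb y (nb x t) - zlab Pc nb y (nb x t')) = sqNormInt (t - t') := by
  have htie := scales_tied (hch x hx) (hch y hy) hx ⟨hy, hxy⟩
  have h1 := zlab_spec hch hy (nb_mem hch hx ht).1 hzt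
  have h2 := zlab_spec hch hy (nb_mem hch hx ht').1 hzt'
  exact sqNormInt_transfer (hch x hx) (hch y hy) htie.1 htie.2 (Or.inr ⟨ht, rfl⟩) (Or.inr ⟨ht', rfl⟩)
    (Or.inr ⟨h1.1, h1.2.symm⟩) (Or.inr ⟨h2.1, h2.2.symm⟩)

/-- **Transfer for a labelled neighbour of `x` and `x` itself**, read at the bonded site `y`:
`D(label of z, label of x) = 18`… more precisely `= sqNormInt t`. [folklore] -/
theorem transfer_nb_centre (hch : ∀ z ∈ S, IsZChart S z (ac z) (Pc z) (Ac z) (nb z)) {x y : (EuclideanSpace ℝ (Fin 3))}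
    (hx : x ∈ S) (hy : y ∈ S) (hxy : 0 < dist x y ∧ dist x y ≤ 28 / 25)
    {t : Fin 3 → ℤ} (ht : t ∈ Pc x) (hzt : 0 < dist y (nb x t) ∧ dist y (nb x t) ≤ 28 / 25) :
    sqNormInt (zlab Pc nb y (nb x t) - zlab Pc nb y x) = sqNormInt t := by
  have htie := scales_tied (hch x hx) (hch y hy) hx ⟨hy, hxy⟩
  have h1 := zlab_spec hch hy (nb_mem hch hx ht).1 hzt
  have h2 := zlab_spec hch hy hx (bond_symm hxy)
  have := sqNormInt_transfer (hch x hx) (hch y hy) htie.1 htie.2 (Or.inr ⟨ht, rfl⟩) (Or.inl ⟨rfl, rfl⟩)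
    (Or.inr ⟨h1.1, h1.2.symm⟩) (Or.inr ⟨h2.1, h2.2.symm⟩)
  rw [this, sub_zero]

/-- **Transfer for a labelled neighbour of `x` and `y` itself** (`y = nb x t₀`): the label of
`nb x t` at `y` has `sqNormInt = sqNormInt (t − t₀)`. [folklore] -/
theorem transfer_nb_target (hch : ∀ z ∈ S, IsZChart S z (ac z) (Pc z) (Ac z) (nb z)) {x : (EuclideanSpace ℝ (Fin 3))}
    (hx : x ∈ S) {t₀ t : Fin 3 → ℤ} (ht₀ : t₀ ∈ Pc x) (ht : t ∈ Pc x)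
    (hzt : 0 < dist (nb x t₀) (nb x t) ∧ dist (nb x t₀) (nb x t) ≤ 28 / 25) :
    sqNormInt (zlab Pc nb (nb x t₀) (nb x t)) = sqNormInt (t - t₀) := by
  have hy := nb_mem hch hx ht₀
  have htie := scales_tied (hch x hx) (hch _ hy.1) hx ⟨hy.1, hy.2⟩
  have h1 := zlab_spec hch hy.1 (nb_mem hch hx ht).1 hzt
  have := sqNormInt_transfer (hch x hx) (hch _ hy.1) htie.1 htie.2 (Or.inr ⟨ht, rfl⟩) (Or.inr ⟨ht₀, rfl⟩)
    (Or.inr ⟨h1.1, h1.2.symm⟩) (Or.inl ⟨rfl, rfl⟩)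
  rw [sub_zero] at this
  exact this

/-- The label of the centre `x` at a labelled neighbour `y = nb x t₀` has squared norm `18`.
[folklore] -/
theorem sqNormInt_zlab_centre (hch : ∀ z ∈ S, IsZChart S z (ac z) (Pc z) (Ac z) (nb z)) {x : (EuclideanSpace ℝ (Fin 3))}
    (hx : x ∈ S) {t₀ : Fin 3 → ℤ} (ht₀ : t₀ ∈ Pc x) :
    sqNormInt (zlab Pc nb (nb x t₀) x) = 18 := by
  have hy := nb_mem hch hx ht₀
  have h := zlab_spec hch hy.1 hx (bond_symm hy.2)
  exact (hch _ hy.1).sqNormInt_eq h.1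


/-! ## The in-layer steps -/

/-- Membership of the six hexagon labels (for rewriting). [folklore] -/
theorem mem_hexLabels_iff {t₁ t₂ p : Fin 3 → ℤ} :
    p ∈ hexLabels t₁ t₂ ↔ p = t₁ ∨ p = t₂ ∨ p = t₂ - t₁ ∨ p = -t₁ ∨ p = -t₂ ∨ p = t₁ - t₂ := by
  simp only [hexLabels, Finset.mem_insert, Finset.mem_singleton]

/-- Membership in a lower cap, unfolded. [folklore] -/
theorem mem_lowerCap_iff {P : Finset (Fin 3 → ℤ)} {t₁ t₂ : Fin 3 → ℤ} {U : Finset (Fin 3 → ℤ)}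
    {p : Fin 3 → ℤ} : p ∈ lowerCap P t₁ t₂ U ↔ p ∈ P ∧ p ∉ hexLabels t₁ t₂ ∧ p ∉ U := by
  simp only [lowerCap, Finset.mem_filter]

/-- **The mirror-pair argument** (regime B): if the source pattern of a valid frame is HCP then,
at the neighbour `y = nb x t` for a hexagon label `t`, the labels of `x` and of any common
neighbour touching the transported upper AND lower cap images are equatorial, and `y` is HCP.
Stated for the data actually used: two common neighbours `u = nb x cu`, `l = nb x cl` of `x, y`
with `sqNormInt (cu − cl) = 48` force `Pc y = hcpInt`, and a label at `y` touching both of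
their labels is equatorial. [folklore] -/
theorem hcp_of_mirror_pair (hch : ∀ z ∈ S, IsZChart S z (ac z) (Pc z) (Ac z) (nb z)) {x : (EuclideanSpace ℝ (Fin 3))}
    (hx : x ∈ S) {t cu cl : Fin 3 → ℤ} (ht : t ∈ Pc x) (hcu : cu ∈ Pc x) (hcl : cl ∈ Pc x)
    (h48 : sqNormInt (cu - cl) = 48)
    (hbu : 0 < dist (nb x t) (nb x cu) ∧ dist (nb x t) (nb x cu) ≤ 28 / 25)
    (hbl : 0 < dist (nb x t) (nb x cl) ∧ dist (nb x t) (nb x cl) ≤ 28 / 25) :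
    Pc (nb x t) = hcpInt ∧
      ∀ q ∈ Pc (nb x t), sqNormInt (q - zlab Pc nb (nb x t) (nb x cu)) = 18 →
        sqNormInt (q - zlab Pc nb (nb x t) (nb x cl)) = 18 → -q ∈ Pc (nb x t) := by
  have hy := nb_mem hch hx ht
  have hμ := zlab_spec hch hy.1 (nb_mem hch hx hcu).1 hbu
  have hlam := zlab_spec hch hy.1 (nb_mem hch hx hcl).1 hbl
  have D : sqNormInt (zlab Pc nb (nb x t) (nb x cu) - zlab Pc nb (nb x t) (nb x cl)) = 48 := by
    rw [transfer_nb_nb hch hx hy.1 hy.2 hcu hcl hbu hbl, h48]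
  have hPy : Pc (nb x t) = hcpInt := by
    rcases pattern_cases hch hy.1 with h | h
    · exfalso
      rw [h] at hμ hlam
      exact sqNormInt_sub_ne_48_of_fcc3Int _ hμ.1 _ hlam.1 D
    · exact h
  refine ⟨hPy, fun q hq h1 h2 => ?_⟩
  rw [hPy] at hq hμ hlam ⊢
  exact neg_mem_of_mirror_pair q hq _ hμ.1 _ hlam.1 h1 h2 D

end Summit.AtomisticToContinuum.Crystallization.Theorems.PalmUnimodularRigidityShellsToBarlowChart

end
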